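import Literature.Geometry.Lorentzian.CauchyDevelopment
import Literature.Geometry.Lorentzian.CausalityProofs
import Literature.Geometry.Riemannian.ChangGurskyYangProofs
import HarnessLib

/-!
# Constant rescaling of Lorentzian metrics, time orientations and spacetimes

For a Lorentzian metric `g` on `M` and a constant `c > 0`, the rescaled metric `c g`
(`LorentzianMetric.constSmul`, built on `PseudoRiemannianMetric.constSmul` of
`Riemannian/RicciFlowScaling.lean`) is again Lorentzian, with the same timelike / null / causal
vectors, the same time cones (`TimeOrientation.constSmul`: the same orienting vector field), hence
the same timelike and causal curves, the same chronological and causal futures and pasts, the same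
endless curves and the same Cauchy hypersurfaces; `Spacetime.constSmul` bundles this. We also record
the invariance of isometric immersions (both metrics rescaled by the same constant), of
time-orientation preservation, of the Levi-Civita connection and Ricci-flatness
(`leviCivita_constSmul`, `ricci_constSmul` of `Riemannian/ChangGurskyYangProofs.lean`), the scaling
`K^{c g}_ν = c K^g_ν` of the second fundamental form, and the future unit normal `a⁻¹ ν` of the
rescaled metric `a² g`. This is the bookkeeping behind the dilation covariance of Cauchy developments
(`CauchyDevelopmentConstSmul.lean`). Everything is elementary: O'Neill 1983, Ch. 3 (Def. 3.1,
Thm. 3.11: a constant conformal factor does not change the Levi-Civita connection), Ch. 5 (causal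
character), Ch. 14 (causality relations depend on the metric only through its null cones).

## References

* B. O'Neill, *Semi-Riemannian geometry with applications to relativity*, Academic Press 1983,
  Ch. 3, Def. 3.1, Thm. 3.11; Ch. 5, pp. 140–145; Ch. 14, pp. 402–415. [ONeill1983]
* P. Topping, *Lectures on the Ricci flow*, LMS LNS 325 (2006), §1.2.3 (rescaling). [Topping2006]
-/

noncomputable section

open Manifold Bundle TopologicalSpace Set
open scoped ContDiff Topology

universe u

namespace Literature.Geometry.Lorentzian

variable {E : Type*} [NormedAddCommGroup E] [NormedSpace ℝ E] {H : Type*} [TopologicalSpace H]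
  {I : ModelWithCorners ℝ E H} {n : ℕ∞ω} {M : Type*} [TopologicalSpace M] [ChartedSpace H M]
  [IsManifold I ∞ M]

/-! ### Rescaled Lorentzian metrics -/

namespace LorentzianMetric

/-- **Constant rescaling of a Lorentzian metric.** For `c > 0`, `g.constSmul c hc` is the Lorentzian
metric `c g` (`(c g)_x(v, w) = c g_x(v, w)`): the pseudo-Riemannian metric
`g.toPseudoRiemannianMetric.constSmul c _`, which has the same timelike vectors and the same
(positive definite) orthogonal complements since `c > 0`. O'Neill 1983, Ch. 3, Def. 3.1 and p. 55.
[cite: ONeill1983, Ch. 3, Def. 3.1] -/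
def constSmul (g : LorentzianMetric I n M) (c : ℝ) (hc : 0 < c) : LorentzianMetric I n M where
  toPseudoRiemannianMetric := g.toPseudoRiemannianMetric.constSmul c hc.ne'
  exists_timelike x := by
    obtain ⟨v, hv⟩ := g.exists_timelike x
    exact ⟨v, by
      rw [PseudoRiemannianMetric.constSmul_apply]
      exact mul_neg_of_pos_of_neg hc hv⟩
  pos_of_orthogonal x v w hv hvw hw := by
    rw [PseudoRiemannianMetric.constSmul_apply] at hv hvw ⊢
    have hv' : g.val x v v < 0 := by
      by_contra h
      exact (not_le.mpr hv) (mul_nonneg hc.le (not_lt.mp h))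
    have hvw' : g.val x v w = 0 := by
      rcases mul_eq_zero.mp hvw with h | h
      · exact absurd h hc.ne'
      · exact h
    exact mul_pos hc (g.pos_of_orthogonal x v w hv' hvw' hw)

variable (g : LorentzianMetric I n M) {c : ℝ} (hc : 0 < c)

/-- The pseudo-Riemannian metric of `c g` is `c • g`. [folklore] -/
@[simp]
lemma toPseudoRiemannianMetric_constSmul :
    (g.constSmul c hc).toPseudoRiemannianMetric = g.toPseudoRiemannianMetric.constSmul c hc.ne' :=
  rfl

/-- The value of `c g`: `(c g)_x = c • g_x`. [folklore] -/
@[simp]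
lemma val_constSmul (x : M) : (g.constSmul c hc).val x = c • g.val x := rfl

/-- The value of `c g` on vectors: `(c g)_x(v, w) = c g_x(v, w)`. [folklore] -/
lemma constSmul_apply (x : M) (v w : TangentSpace I x) :
    (g.constSmul c hc).val x v w = c * g.val x v w := rfl

variable {x : M}

/-- `c g` has the same timelike vectors as `g` (`c > 0`). O'Neill 1983, Ch. 3, p. 56. [cite: ONeill1983, Ch. 3, p. 56] -/
lemma isTimelike_constSmul_iff (v : TangentSpace I x) :
    (g.constSmul c hc).IsTimelike v ↔ g.IsTimelike v := by
  simp only [IsTimelike, constSmul_apply]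
  exact ⟨fun h ↦ by
    by_contra h'
    exact (not_le.mpr h) (mul_nonneg hc.le (not_lt.mp h')), fun h ↦ mul_neg_of_pos_of_neg hc h⟩

/-- `c g` has the same null vectors as `g` (`c > 0`). O'Neill 1983, Ch. 3, p. 56. [cite: ONeill1983, Ch. 3, p. 56] -/
lemma isNull_constSmul_iff (v : TangentSpace I x) :
    (g.constSmul c hc).IsNull v ↔ g.IsNull v := by
  simp only [IsNull, constSmul_apply, mul_eq_zero, hc.ne', false_or]

/-- `c g` has the same causal vectors as `g` (`c > 0`). O'Neill 1983, Ch. 5, p. 140. [cite: ONeill1983, Ch. 5, p. 140] -/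
lemma isCausal_constSmul_iff (v : TangentSpace I x) :
    (g.constSmul c hc).IsCausal v ↔ g.IsCausal v := by
  simp only [IsCausal, constSmul_apply]
  refine and_congr ⟨fun h ↦ ?_, fun h ↦ mul_nonpos_of_nonneg_of_nonpos hc.le h⟩ Iff.rfl
  by_contra h'
  exact (not_lt.mpr h) (mul_pos hc (not_le.mp h'))

end LorentzianMetric

/-! ### Rescaled time orientations -/

namespace TimeOrientation

variable {g : LorentzianMetric I n M} (τ : TimeOrientation g) {c : ℝ} (hc : 0 < c)

variable (c) in
/-- **The time orientation of `c g` induced by a time orientation of `g`**: the same orienting vector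
field (timelike for `c g` as well, `c > 0`). O'Neill 1983, Ch. 5, p. 145 (time cones depend only on
the conformal class). [cite: ONeill1983, Ch. 5, p. 145] -/
def constSmul (hc : 0 < c) : TimeOrientation (g.constSmul c hc) where
  vectorField := τ.vectorField
  isTimelike x := (g.isTimelike_constSmul_iff hc _).2 (τ.isTimelike x)
  contMDiff := τ.contMDiff

/-- The orienting vector field of the rescaled time orientation is the original one. [folklore] -/
@[simp]
lemma vectorField_constSmul (x : M) : (τ.constSmul c hc).vectorField x = τ.vectorField x := rfl

/-- Reversal commutes with rescaling. [folklore] -/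
lemma reverse_constSmul : (τ.constSmul c hc).reverse = τ.reverse.constSmul c hc := rfl

variable {x : M}

/-- Future-directedness is unchanged under `g ↦ c g` (`c > 0`). O'Neill 1983, Ch. 5, p. 145. [cite: ONeill1983, Ch. 5, p. 145] -/
lemma isFutureDirected_constSmul_iff (v : TangentSpace I x) :
    (τ.constSmul c hc).IsFutureDirected v ↔ τ.IsFutureDirected v := by
  simp only [IsFutureDirected, g.isCausal_constSmul_iff hc, vectorField_constSmul,
    LorentzianMetric.constSmul_apply]
  refine and_congr Iff.rfl ⟨fun h ↦ ?_, fun h ↦ mul_neg_of_pos_of_neg hc h⟩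
  by_contra h'
  exact (not_le.mpr h) (mul_nonneg hc.le (not_lt.mp h'))

/-- Past-directedness is unchanged under `g ↦ c g` (`c > 0`). O'Neill 1983, Ch. 5, p. 145. [cite: ONeill1983, Ch. 5, p. 145] -/
lemma isPastDirected_constSmul_iff (v : TangentSpace I x) :
    (τ.constSmul c hc).IsPastDirected v ↔ τ.IsPastDirected v := by
  rw [← isFutureDirected_neg_iff, ← isFutureDirected_neg_iff, isFutureDirected_constSmul_iff]

/-- Time-orientation preservation is unchanged when source and target metrics are rescaled by
positive constants (the orienting fields and the future cones are the same). O'Neill 1983, Ch. 5,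
p. 145. [cite: ONeill1983, Ch. 5, p. 145] -/
lemma preservesTimeOrientation_constSmul_iff
    {E' : Type*} [NormedAddCommGroup E'] [NormedSpace ℝ E'] {H' : Type*} [TopologicalSpace H']
    {I' : ModelWithCorners ℝ E' H'} {N : Type*} [TopologicalSpace N] [ChartedSpace H' N]
    [IsManifold I' ∞ N] {gN : LorentzianMetric I' n N} (τN : TimeOrientation gN) {c' : ℝ}
    (hc' : 0 < c') (f : N → M) :
    (τN.constSmul c' hc').PreservesTimeOrientation f (τ.constSmul c hc) ↔
      τN.PreservesTimeOrientation f τ :=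
  forall_congr' fun y ↦ by rw [vectorField_constSmul, isFutureDirected_constSmul_iff]

end TimeOrientation

/-! ### Curves, causal relations and Cauchy hypersurfaces are unchanged -/

namespace LorentzianMetric

variable (g : LorentzianMetric I n M) (τ : TimeOrientation g) {c : ℝ} (hc : 0 < c)

/-- Future-directed timelike curves are the same for `g` and `c g`. O'Neill 1983, Ch. 14, p. 402. [cite: ONeill1983, Ch. 14, p. 402] -/
lemma isFutureTimelikeCurveOn_constSmul_iff (γ : ℝ → M) (s : Set ℝ) :
    (g.constSmul c hc).IsFutureTimelikeCurveOn (τ.constSmul c hc) γ s ↔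
      g.IsFutureTimelikeCurveOn τ γ s := by
  simp only [IsFutureTimelikeCurveOn, g.isTimelike_constSmul_iff hc,
    τ.isFutureDirected_constSmul_iff hc]

/-- Future-directed causal curves are the same for `g` and `c g`. O'Neill 1983, Ch. 14, p. 402. [cite: ONeill1983, Ch. 14, p. 402] -/
lemma isFutureCausalCurveOn_constSmul_iff (γ : ℝ → M) (s : Set ℝ) :
    (g.constSmul c hc).IsFutureCausalCurveOn (τ.constSmul c hc) γ s ↔
      g.IsFutureCausalCurveOn τ γ s := by
  simp only [IsFutureCausalCurveOn, τ.isFutureDirected_constSmul_iff hc]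

/-- `I⁺` is the same for `g` and `c g`. O'Neill 1983, Ch. 14, pp. 402–403. [cite: ONeill1983, Ch. 14, pp. 402–403] -/
lemma chronologicalFuture_constSmul (S : Set M) :
    (g.constSmul c hc).chronologicalFuture (τ.constSmul c hc) S = g.chronologicalFuture τ S := by
  simp only [chronologicalFuture, g.isFutureTimelikeCurveOn_constSmul_iff τ hc]

/-- `J⁺` is the same for `g` and `c g`. O'Neill 1983, Ch. 14, pp. 402–403. [cite: ONeill1983, Ch. 14, pp. 402–403] -/
lemma causalFuture_constSmul (S : Set M) :
    (g.constSmul c hc).causalFuture (τ.constSmul c hc) S = g.causalFuture τ S := by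
  simp only [causalFuture, g.isFutureCausalCurveOn_constSmul_iff τ hc]

/-- `I⁻` is the same for `g` and `c g`. O'Neill 1983, Ch. 14, p. 403. [cite: ONeill1983, Ch. 14, p. 403] -/
lemma chronologicalPast_constSmul (S : Set M) :
    (g.constSmul c hc).chronologicalPast (τ.constSmul c hc) S = g.chronologicalPast τ S := by
  rw [chronologicalPast, chronologicalPast, TimeOrientation.reverse_constSmul,
    chronologicalFuture_constSmul]

/-- `J⁻` is the same for `g` and `c g`. O'Neill 1983, Ch. 14, p. 403. [cite: ONeill1983, Ch. 14, p. 403] -/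
lemma causalPast_constSmul (S : Set M) :
    (g.constSmul c hc).causalPast (τ.constSmul c hc) S = g.causalPast τ S := by
  rw [causalPast, causalPast, TimeOrientation.reverse_constSmul, causalFuture_constSmul]

/-- Endless timelike curves are the same for `g` and `c g` (endlessness does not involve the
metric). O'Neill 1983, Ch. 14, Def. 14.28. [cite: ONeill1983, Ch. 14, Def. 14.28] -/
lemma isEndlessTimelikeCurve_constSmul_iff (γ : ℝ → M) (s : Set ℝ) :
    (g.constSmul c hc).IsEndlessTimelikeCurve (τ.constSmul c hc) γ s ↔
      g.IsEndlessTimelikeCurve τ γ s := by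
  simp only [IsEndlessTimelikeCurve, g.isFutureTimelikeCurveOn_constSmul_iff τ hc]

/-- **Cauchy hypersurfaces are the same for `g` and `c g`** (they are met exactly once by the same
endless timelike curves). O'Neill 1983, Ch. 14, Def. 14.28. [cite: ONeill1983, Ch. 14, Def. 14.28] -/
lemma isCauchyHypersurface_constSmul_iff (S : Set M) :
    (g.constSmul c hc).IsCauchyHypersurface (τ.constSmul c hc) S ↔ g.IsCauchyHypersurface τ S := by
  simp only [IsCauchyHypersurface, g.isEndlessTimelikeCurve_constSmul_iff τ hc]

end LorentzianMetric

/-! ### Rescaled spacetimes -/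

namespace Spacetime

variable {d : ℕ}

/-- **The rescaled spacetime `(M, c g, τ)`** of a spacetime `(M, g, τ)`, `c > 0`: same carrier, metric
`c g`, same orienting vector field. Hawking–Ellis 1973, §3.1; O'Neill 1983, Ch. 3, Def. 3.1.
[cite: ONeill1983, Ch. 3, Def. 3.1] -/
def constSmul (S : Spacetime.{u} d) (c : ℝ) (hc : 0 < c) : Spacetime.{u} d :=
  { carrier := S.carrier
    metric := S.metric.constSmul c hc
    timeOrientation := S.timeOrientation.constSmul c hc }

variable (S : Spacetime.{u} d) {c : ℝ} (hc : 0 < c)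

/-- The carrier of the rescaled spacetime is the original carrier. [folklore] -/
lemma carrier_constSmul : (S.constSmul c hc).carrier = S.carrier := rfl

/-- The metric of the rescaled spacetime is `c g`. [folklore] -/
lemma metric_constSmul : (S.constSmul c hc).metric = S.metric.constSmul c hc := rfl

/-- The time orientation of the rescaled spacetime is the rescaled time orientation. [folklore] -/
lemma timeOrientation_constSmul :
    (S.constSmul c hc).timeOrientation = S.timeOrientation.constSmul c hc := rfl

end Spacetime

/-! ### Pullbacks, isometric immersions, unit normals -/

section Immersions

variable {E' : Type*} [NormedAddCommGroup E'] [NormedSpace ℝ E'] {H' : Type*} [TopologicalSpace H']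
  {I' : ModelWithCorners ℝ E' H'} {N : Type*} [TopologicalSpace N] [ChartedSpace H' N]

omit [IsManifold I ∞ M] in
/-- Pullback commutes with constant rescaling: `f^*(c b) = c f^* b`. O'Neill 1983, Ch. 3, p. 58. [folklore] -/
lemma pullbackBilin_const_smul (f : N → M)
    (b : Π x : M, TangentSpace I x →L[ℝ] TangentSpace I x →L[ℝ] ℝ) (c : ℝ) (y : N) :
    pullbackBilin (I := I) (I' := I') f (fun x ↦ c • b x) y =
      c • pullbackBilin (I := I) (I' := I') f b y := by
  ext v w
  simp only [pullbackBilin_apply, FunLike.coe_smul, Pi.smul_apply]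

variable [IsManifold I' ∞ N]

/-- **Isometric immersions are unchanged when both metrics are rescaled by the same constant**
`c ≠ 0`: `f^*(c g_M) = c f^* g_M = c g_N`. O'Neill 1983, Ch. 3, p. 58. [folklore] -/
lemma PseudoRiemannianMetric.isIsometricImmersion_constSmul_iff
    (gN : PseudoRiemannianMetric I' n E' (TangentSpace I' : N → Type _))
    (gM : PseudoRiemannianMetric I n E (TangentSpace I : M → Type _)) {c : ℝ} (hc : c ≠ 0)
    (f : N → M) :
    (gN.constSmul c hc).IsIsometricImmersion (gM.constSmul c hc) f ↔
      gN.IsIsometricImmersion gM f := by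
  refine and_congr Iff.rfl (forall_congr' fun y ↦ ?_)
  have h : (gM.constSmul c hc).val = fun x ↦ c • gM.val x := rfl
  rw [h, pullbackBilin_const_smul, PseudoRiemannianMetric.val_constSmul]
  exact ⟨fun h' ↦ smul_right_injective _ hc h', fun h' ↦ by rw [h']⟩

omit [IsManifold I' ∞ N] in
/-- **The future unit normal of the rescaled metric.** For `a > 0`, `a⁻¹ ν` is the future unit normal
of `f` for `(a² g, τ)` iff `ν` is the future unit normal of `f` for `(g, τ)`:
`a² g(a⁻¹ν, df v) = a g(ν, df v)`, `a² g(a⁻¹ν, a⁻¹ν) = g(ν, ν)`, and positive multiples of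
future-directed vectors are future-directed. O'Neill 1983, Ch. 4, pp. 106–107; Ch. 5, p. 145.
[cite: ONeill1983, Ch. 4, pp. 106–107] -/
lemma LorentzianMetric.isFutureUnitNormal_constSmul_iff (g : LorentzianMetric I n M)
    (τ : TimeOrientation g) {a : ℝ} (ha : 0 < a) (f : N → M) (ν : NormalField I f) :
    (g.constSmul (a ^ 2) (pow_pos ha 2)).IsFutureUnitNormal I'
        (τ.constSmul (a ^ 2) (pow_pos ha 2)) f (a⁻¹ • ν) ↔
      g.IsFutureUnitNormal I' τ f ν := by
  have ha0 : a ≠ 0 := ha.ne'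
  have hfd : ∀ y, (τ.constSmul (a ^ 2) (pow_pos ha 2)).IsFutureDirected ((a⁻¹ • ν) y) ↔
      τ.IsFutureDirected (ν y) := fun y ↦ by
    rw [TimeOrientation.isFutureDirected_constSmul_iff, Pi.smul_apply]
    refine ⟨fun h ↦ ?_, fun h ↦ h.smul (inv_pos.2 ha)⟩
    have h' := h.smul ha
    rwa [smul_smul, mul_inv_cancel₀ ha0, one_smul] at h'
  have key1 : ∀ (y : N) (w : TangentSpace I (f y)),
      (g.constSmul (a ^ 2) (pow_pos ha 2)).val (f y) ((a⁻¹ • ν) y) w =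
        a * g.val (f y) (ν y) w := fun y w ↦ by
    rw [LorentzianMetric.constSmul_apply, Pi.smul_apply, map_smul, FunLike.coe_smul,
      Pi.smul_apply, smul_eq_mul]
    field_simp
  have key2 : ∀ y : N, a * g.val (f y) (ν y) ((a⁻¹ • ν) y) = g.val (f y) (ν y) (ν y) := fun y ↦ by
    rw [Pi.smul_apply, map_smul, smul_eq_mul]
    field_simp
  simp only [LorentzianMetric.IsFutureUnitNormal, PseudoRiemannianMetric.IsUnitNormal,
    PseudoRiemannianMetric.IsNormalTo, key1]
  simp only [key2, hfd, mul_eq_zero, ha0, false_or]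

end Immersions

/-! ### Levi-Civita connection, Ricci-flatness and the second fundamental form under `g ↦ c g` -/

namespace PseudoRiemannianMetric

variable (g : PseudoRiemannianMetric I n E (TangentSpace I : M → Type _)) {c : ℝ} (hc : c ≠ 0)

/-- If `c g` has a Levi-Civita connection (standing hypothesis `HasLeviCivita`) then so has
`g = c⁻¹ (c g)`. O'Neill 1983, Ch. 3, Thm. 3.11; Topping 2006, §1.2.3. [cite: Topping2006, §1.2.3] -/
theorem hasLeviCivita_of_constSmul [h : (g.constSmul c hc).HasLeviCivita] : g.HasLeviCivita := by
  have h' := HasLeviCivita.constSmul (g := g.constSmul c hc) c⁻¹ (inv_ne_zero hc)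
  rwa [constSmul_inv_constSmul] at h'

variable [g.HasLeviCivita] [(g.constSmul c hc).HasLeviCivita]

/-- **Ricci-flatness is invariant under constant rescaling**: `Ric(c g) = Ric(g)`
(`ricci_constSmul`). O'Neill 1983, Ch. 3, Thm. 3.11; Topping 2006, §1.2.3, (1.2.8). [cite: Topping2006, §1.2.3] -/
theorem isRicciFlat_constSmul_iff : (g.constSmul c hc).IsRicciFlat ↔ g.IsRicciFlat :=
  forall_congr' fun x ↦ by rw [ricci_constSmul c hc x]

variable {E' : Type*} [NormedAddCommGroup E'] [NormedSpace ℝ E'] {H' : Type*} [TopologicalSpace H']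
  {I' : ModelWithCorners ℝ E' H'} {N : Type*} [TopologicalSpace N] [ChartedSpace H' N]
  [FiniteDimensional ℝ E] (f : N → M) (ν : NormalField I f)

/-- The covariant derivative of a field along `f` is the same for `g` and `c g` (it only involves
the Levi-Civita connection, `leviCivita_constSmul`). O'Neill 1983, Ch. 4, Lemma 4.1. [cite: ONeill1983, Ch. 4, Lemma 4.1] -/
theorem normalDerivAlong_constSmul (y : N) (v : TangentSpace I' y) :
    (g.constSmul c hc).normalDerivAlong f ν y v = g.normalDerivAlong f ν y v := by
  unfold normalDerivAlong
  rw [leviCivita_constSmul c hc]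

variable [FiniteDimensional ℝ E']

/-- **The second fundamental form scales like the metric**: `K^{c g}_ν = c K^g_ν` for a fixed field
`ν` along `f` (same induced connection, `g` enters linearly). O'Neill 1983, Ch. 4, Lemma 4.4 ff.
[cite: ONeill1983, Ch. 4, Lemma 4.4 ff.] -/
theorem secondFundamentalForm_constSmul (y : N) :
    (g.constSmul c hc).secondFundamentalForm I' f ν y = c • g.secondFundamentalForm I' f ν y := by
  haveI : FiniteDimensional ℝ (TangentSpace I' y) := inferInstanceAs (FiniteDimensional ℝ E')
  simp only [secondFundamentalForm, ← map_smul]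
  congr 1
  funext i
  rw [Pi.smul_apply, normalDerivAlong_constSmul, val_constSmul, FunLike.coe_smul, Pi.smul_apply,
    ContinuousLinearMap.toLinearMap_smul, LinearMap.smul_comp]

end PseudoRiemannianMetric

end Literature.Geometry.Lorentzian

end
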